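import Literature.Probability.LatticeModels.HighDimTrivialityWick
import Literature.Probability.LatticeModels.CriticalWickDichotomy
import Literature.Probability.LatticeModels.CriticalScalingDimension
import Summits.CriticalPhenomena.Ising3DConformalLimit.Theses.HyperoctahedralRP
import Summits.CriticalPhenomena.Ising3DConformalLimit.Theorems.InversionUpgradeNormalised.Negative.AutomaticOrders
import Summits.CriticalPhenomena.Ising3DConformalLimit.Theorems.HyperoctahedralRPInversionUpgradeNormalisedEvenPos
import Summits.CriticalPhenomena.Ising3DConformalLimit.Theorems.HyperoctahedralRPInversionUpgradeNormalisedOSLayer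
import HarnessLib

/-!
# Stub 6b `stub_oddOddDecay` of line `Sketch` (crux stmt-CriticalPhenomena-1344 `MoebiusLimitExists`)
= the analytic heart of item stmt-1982's `stub_clustering` (line `free-endpoint-gaussian-closure`)

For a normalised, non-degenerate, Euclidean-invariant, scale-covariant pointwise scaling limit `S` of
`criticalCorr 3` and ODD `n, m`: `S_{n+m}(x, y + t v) → 0` as `t → ∞` (`v ≠ 0`), given the parity lemma with a
price (stub 6a, hypothesis) and Gaussian domination in the limit (1982's landed `stub_gaussianDomination`, hypothesis).

Proof.  If `x` or `y` is not injective, the appended configuration `(x, y + t v)` is never injective and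
the correlator vanishes identically (normalisation).  Otherwise put `C ≥ ‖xᵢ - yⱼ‖` for all `i, j`;
for `t ‖v‖ > C` every cross distance is `≥ L(t) := t ‖v‖ - C > 0` (reverse triangle inequality), so
`(x, y + t v)` is injective, `0 ≤ S_{n+m}(x, y + t v)` (`InversionDefectInvolution.stub_evenPos`,
`n + m = 2k` even) and, after re-indexing along `Fin.cast` (`corr_comp_cast`), Gaussian domination
bounds it by the pairing functional `𝒢_k[S₂]`.  The parity lemma with a price (6a), applied with the odd
block `A = {l | l < n}` of the `x`-indices, bounds the pairing functional by `(2k)! M^{k-1} ε(t)` where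
`M` bounds all pair values (the `y`-pairs are `t`-independent by translation invariance) and
`ε(t) = L(t)^{-2Δ} S₂(0,e₀)` bounds the cross values (`two_point_eq`, antitone in the distance since
`Δ ≥ 1/2 > 0` by `delta_mem_Icc_of_hyp`).  As `ε(t) → 0` (`tendsto_rpow_neg_atTop`), `squeeze_zero'`
concludes.

References: J. Glimm, A. Jaffe, *Quantum Physics* (2nd ed., Springer 1987), §19.3 (cluster
expansion bounds of this parity-with-a-price type).  No definitions are introduced.
-/

noncomputable section

open Filter Topology
open Literature.Probability.LatticeModels Literature.MathematicalPhysics.QuantumFieldTheory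
open EuclideanGeometry

namespace Summit.CriticalPhenomena.Ising3DConformalLimit.Cruxes.InversionUpgradeNormalised.FreeEndpointGaussianClosure

/-! ### Elementary helpers -/

/-- Odd plus odd is even: `n + m = 2k` for some `k`. -/
theorem exists_two_mul_eq_add_of_odd {n m : ℕ} (hn : Odd n) (hm : Odd m) :
    ∃ k, 2 * k = n + m := by
  obtain ⟨a, rfl⟩ := hn
  obtain ⟨b, rfl⟩ := hm
  exact ⟨a + b + 1, by ring⟩

/-- A real function of two arguments ranging over finite types is bounded above. -/
theorem exists_forall_forall_le {ι ι' : Type*} [Finite ι] [Finite ι'] (g : ι → ι' → ℝ) :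
    ∃ C : ℝ, ∀ i j, g i j ≤ C := by
  obtain ⟨C, hC⟩ := (Set.finite_range fun p : ι × ι' => g p.1 p.2).bddAbove
  exact ⟨C, fun i j => hC (Set.mem_range_self (i, j))⟩

/-- Reverse triangle inequality for the cross differences of `(x, y + t v)`:
`t ‖v‖ - ‖a - b‖ ≤ ‖a - (b + t v)‖`. -/
theorem sub_norm_le_norm_sub_add_smul (a b v : EuclideanSpace ℝ (Fin 3)) (t : ℝ) :
    t * ‖v‖ - ‖a - b‖ ≤ ‖a - (b + t • v)‖ := by
  have h1 : ‖t • v‖ - ‖a - b‖ ≤ ‖a - (b + t • v)‖ := by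
    rw [← sub_sub, norm_sub_rev (a - b)]
    exact norm_sub_norm_le _ _
  have h2 : t * ‖v‖ ≤ ‖t • v‖ := by
    rw [norm_smul, Real.norm_eq_abs]
    exact mul_le_mul_of_nonneg_right (le_abs_self t) (norm_nonneg v)
  linarith

/-- Translation invariance of the two-point function: `S₂(b + w, b' + w) = S₂(b, b')`. -/
theorem two_point_add_right {S : CorrFamily 3} (heuc : IsEuclideanInvariant S)
    (b b' w : EuclideanSpace ℝ (Fin 3)) : S 2 ![b + w, b' + w] = S 2 ![b, b'] := by
  rw [← heuc.1 2 w ![b, b']]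
  congr 1
  funext i
  fin_cases i <;> rfl

/-- Decay of the two-point function with the distance: `S₂(u, w) ≤ L^{-2Δ} S₂(0, e₀)` as soon as
`0 < L ≤ ‖u - w‖` (`two_point_eq` and antitonicity of `r ↦ r^{-2Δ}` for `Δ ≥ 0`). -/
theorem two_point_le_rpow_mul {Δ : ℝ} {S : CorrFamily 3} (hnd : IsNondegenerateTwoPoint S)
    (heuc : IsEuclideanInvariant S) (hsc : IsScaleCovariant Δ S) (hΔ : 0 ≤ Δ)
    {u w : EuclideanSpace ℝ (Fin 3)} {L : ℝ} (hL : 0 < L) (h : L ≤ ‖u - w‖) :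
    S 2 ![u, w] ≤ L ^ (-(2 * Δ)) * S 2 ![0, EuclideanSpace.single 0 1] := by
  have huw : u ≠ w := fun he => by
    rw [he, sub_self, norm_zero] at h
    exact absurd h (not_le.2 hL)
  rw [InversionUpgradeNormalisedNegative.two_point_eq heuc hsc huw]
  have hK : 0 ≤ S 2 ![0, EuclideanSpace.single 0 1] :=
    (hnd _ (pair_mem_nonCoincident fun h0 =>
      one_ne_zero ((PiLp.single_eq_zero_iff _ _).1 h0.symm))).le
  exact mul_le_mul_of_nonneg_right (Real.rpow_le_rpow_of_nonpos hL h (by linarith)) hK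

/-! ### The appended configuration `(x, y + w)`: injectivity and pair bounds -/

/-- If `(x, y + w)` is injective then so are `x` and `y`. -/
theorem injective_of_append_add {n m : ℕ} {x : Fin n → EuclideanSpace ℝ (Fin 3)}
    {y : Fin m → EuclideanSpace ℝ (Fin 3)} {w : EuclideanSpace ℝ (Fin 3)}
    (h : Function.Injective (Fin.append x (fun j => y j + w))) :
    Function.Injective x ∧ Function.Injective y :=
  ⟨(Fin.append_injective_iff.1 h).1, fun _ _ hjj' =>
    (Fin.append_injective_iff.1 h).2.1 (congrArg (· + w) hjj' :)⟩

/-- `(x, y + w)` is injective when `x`, `y` are and the two blocks are a positive distance apart. -/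
theorem append_add_injective {n m : ℕ} {x : Fin n → EuclideanSpace ℝ (Fin 3)}
    {y : Fin m → EuclideanSpace ℝ (Fin 3)} {w : EuclideanSpace ℝ (Fin 3)} {L : ℝ}
    (hx : Function.Injective x) (hy : Function.Injective y) (hL : 0 < L)
    (hfar : ∀ i j, L ≤ ‖x i - (y j + w)‖) :
    Function.Injective (Fin.append x (fun j => y j + w)) := by
  refine Fin.append_injective_iff.2 ⟨hx, fun j j' h => hy (add_right_cancel h), fun i j he => ?_⟩
  have h := hfar i j
  rw [he, sub_self, norm_zero] at h
  exact absurd h (not_le.2 hL)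

/-- **Cross pairs are small.**  For one index in the `x`-block `{l | l < n}` and one outside it, both
two-point values of the pair of points of `(x, y + w)` are at most `L^{-2Δ} S₂(0, e₀)` once the
blocks are `L > 0` apart. -/
theorem cross_pair_le {Δ : ℝ} {S : CorrFamily 3} (hnd : IsNondegenerateTwoPoint S)
    (heuc : IsEuclideanInvariant S) (hsc : IsScaleCovariant Δ S) (hΔ : 0 ≤ Δ) {n m : ℕ}
    {x : Fin n → EuclideanSpace ℝ (Fin 3)} {y : Fin m → EuclideanSpace ℝ (Fin 3)}
    {w : EuclideanSpace ℝ (Fin 3)} {L : ℝ} (hL : 0 < L) (hfar : ∀ i j, L ≤ ‖x i - (y j + w)‖)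
    {l l' : Fin (n + m)} (hl : (l : ℕ) < n) (hl' : ¬ (l' : ℕ) < n) :
    S 2 ![Fin.append x (fun j => y j + w) l, Fin.append x (fun j => y j + w) l'] ≤
        L ^ (-(2 * Δ)) * S 2 ![0, EuclideanSpace.single 0 1] ∧
      S 2 ![Fin.append x (fun j => y j + w) l', Fin.append x (fun j => y j + w) l] ≤
        L ^ (-(2 * Δ)) * S 2 ![0, EuclideanSpace.single 0 1] := by
  cases l using Fin.addCases with
  | left i =>
    cases l' using Fin.addCases with
    | left i' => exact absurd (Fin.castAdd_lt m i') hl'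
    | right j =>
      simp only [Fin.append_left, Fin.append_right]
      exact ⟨two_point_le_rpow_mul hnd heuc hsc hΔ hL (hfar i j),
        two_point_le_rpow_mul hnd heuc hsc hΔ hL (by rw [norm_sub_rev]; exact hfar i j)⟩
  | right j =>
    rw [Fin.val_natAdd] at hl
    omega

/-- **All pairs are bounded.**  Every two-point value of a pair of points of `(x, y + w)` is at most
`M` once the `x`-pairs and the `y`-pairs are (the `y`-block is a translate of `y`) and the cross bound
`L^{-2Δ} S₂(0, e₀) ≤ M`. -/
theorem pair_le_of_blocks {Δ : ℝ} {S : CorrFamily 3} (hnd : IsNondegenerateTwoPoint S)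
    (heuc : IsEuclideanInvariant S) (hsc : IsScaleCovariant Δ S) (hΔ : 0 ≤ Δ) {n m : ℕ}
    {x : Fin n → EuclideanSpace ℝ (Fin 3)} {y : Fin m → EuclideanSpace ℝ (Fin 3)}
    {w : EuclideanSpace ℝ (Fin 3)} {L M : ℝ} (hL : 0 < L) (hfar : ∀ i j, L ≤ ‖x i - (y j + w)‖)
    (hLM : L ^ (-(2 * Δ)) * S 2 ![0, EuclideanSpace.single 0 1] ≤ M)
    (hMx : ∀ i i', S 2 ![x i, x i'] ≤ M) (hMy : ∀ j j', S 2 ![y j, y j'] ≤ M)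
    (l l' : Fin (n + m)) :
    S 2 ![Fin.append x (fun j => y j + w) l, Fin.append x (fun j => y j + w) l'] ≤ M := by
  cases l using Fin.addCases with
  | left i =>
    cases l' using Fin.addCases with
    | left i' => simpa only [Fin.append_left] using hMx i i'
    | right j' =>
      simp only [Fin.append_left, Fin.append_right]
      exact (two_point_le_rpow_mul hnd heuc hsc hΔ hL (hfar i j')).trans hLM
  | right j =>
    cases l' using Fin.addCases with
    | left i' =>
      simp only [Fin.append_left, Fin.append_right]
      exact (two_point_le_rpow_mul hnd heuc hsc hΔ hL (by rw [norm_sub_rev]; exact hfar i' j)).trans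
        hLM
    | right j' =>
      simp only [Fin.append_right]
      rw [two_point_add_right heuc]
      exact hMy j j'

/-! ### The decay for injective blocks -/

/-- **Odd|odd decay, injective case.**  Under the parity lemma with a price (6a) and Gaussian
domination in the limit, for injective `x : Fin n → ℝ³`, `y : Fin m → ℝ³` with `n, m` odd and
`v ≠ 0`, `S_{n+m}(x, y + t v) → 0` as `t → ∞`: eventually
`0 ≤ S_{n+m}(x, y + t v) ≤ 𝒢_k[S₂](x, y + t v) ≤ (2k)! M^{k-1} ε(t)` with
`ε(t) = (t‖v‖ - C)^{-2Δ} S₂(0,e₀) → 0`. -/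
theorem tendsto_append_add_smul_of_injective
    (h6a : ∀ (f : EuclideanSpace ℝ (Fin 3) → EuclideanSpace ℝ (Fin 3) → ℝ) (k : ℕ)
      (z : Fin (2 * k) → EuclideanSpace ℝ (Fin 3)) (A : Finset (Fin (2 * k))) (M ε : ℝ),
      Odd A.card → 0 ≤ M → 0 ≤ ε →
      (∀ i j, i ≠ j → 0 ≤ f (z i) (z j) ∧ f (z i) (z j) ≤ M) →
      (∀ i j, i ∈ A → j ∉ A → f (z i) (z j) ≤ ε ∧ f (z j) (z i) ≤ ε) →
      pairingSum f k z ≤ (Nat.factorial (2 * k) : ℝ) * M ^ (k - 1) * ε)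
    (hGD : ∀ (ρ : ℝ → ℝ) (S : CorrFamily 3), (∀ δ ∈ Set.Ioc (0:ℝ) 1, 0 < ρ δ) →
      HasPointwiseScalingLimit (criticalCorr 3) ρ S →
      ∀ (n : ℕ) (x : Fin (2 * n) → EuclideanSpace ℝ (Fin 3)), x ∈ NonCoincident 3 (2 * n) →
        S (2 * n) x ≤ pairingSum (fun a b => S 2 ![a, b]) n x)
    {ρ : ℝ → ℝ} {Δ : ℝ} {S : CorrFamily 3} (hρ : ∀ δ ∈ Set.Ioc (0:ℝ) 1, 0 < ρ δ)
    (hlim : HasPointwiseScalingLimit (criticalCorr 3) ρ S) (hnd : IsNondegenerateTwoPoint S)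
    (heuc : IsEuclideanInvariant S) (hsc : IsScaleCovariant Δ S) {n m : ℕ}
    {x : Fin n → EuclideanSpace ℝ (Fin 3)} {y : Fin m → EuclideanSpace ℝ (Fin 3)}
    {v : EuclideanSpace ℝ (Fin 3)} (hx : Function.Injective x) (hy : Function.Injective y)
    (hn : Odd n) (hm : Odd m) (hv : v ≠ 0) :
    Tendsto (fun t : ℝ => S (n + m) (Fin.append x (fun j => y j + t • v))) atTop (𝓝 0) := by
  obtain ⟨k, hk⟩ := exists_two_mul_eq_add_of_odd hn hm
  have hΔ' := (InversionUpgradeNormalisedNegative.delta_mem_Icc_of_hyp hρ hlim hnd hsc).1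
  have hΔ : 0 ≤ Δ := by linarith
  have h2Δ : 0 < 2 * Δ := by linarith
  -- `t`-independent constants: `C` bounds the cross distances at `t = 0`, `M ≥ 1` all block pairs
  obtain ⟨C, hC⟩ := exists_forall_forall_le fun i j => ‖x i - y j‖
  obtain ⟨Mx, hMx⟩ := exists_forall_forall_le fun i i' => S 2 ![x i, x i']
  obtain ⟨My, hMy⟩ := exists_forall_forall_le fun j j' => S 2 ![y j, y j']
  obtain ⟨M, hM1, hMxM, hMyM⟩ : ∃ M : ℝ, 1 ≤ M ∧ Mx ≤ M ∧ My ≤ M :=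
    ⟨max 1 (max Mx My), le_max_left _ _, (le_max_left _ _).trans (le_max_right _ _),
      (le_max_right _ _).trans (le_max_right _ _)⟩
  have hM0 : 0 ≤ M := zero_le_one.trans hM1
  set K : ℝ := S 2 ![0, EuclideanSpace.single 0 1] with hK
  have hK0 : 0 ≤ K :=
    (hnd _ (pair_mem_nonCoincident fun h0 =>
      one_ne_zero ((PiLp.single_eq_zero_iff _ _).1 h0.symm))).le
  have hvpos : 0 < ‖v‖ := norm_pos_iff.2 hv
  -- the distance scale `L(t) = t ‖v‖ - C → ∞` and the cross bound `ε(t) = L(t)^{-2Δ} K → 0`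
  have hL : Tendsto (fun t : ℝ => t * ‖v‖ - C) atTop atTop := by
    simpa only [sub_eq_add_neg, id] using
      tendsto_atTop_add_const_right atTop (-C) (tendsto_id.atTop_mul_const hvpos)
  have hε : Tendsto (fun t : ℝ => (t * ‖v‖ - C) ^ (-(2 * Δ)) * K) atTop (𝓝 0) := by
    simpa only [zero_mul, Function.comp_def] using
      ((tendsto_rpow_neg_atTop h2Δ).comp hL).mul_const K
  have hev : ∀ᶠ t in atTop, 0 < t * ‖v‖ - C ∧ (t * ‖v‖ - C) ^ (-(2 * Δ)) * K ≤ 1 :=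
    (hL.eventually_gt_atTop 0).and (hε.eventually (eventually_le_nhds one_pos))
  -- the main estimate, for `L(t) > 0` and `ε(t) ≤ 1`
  have key : ∀ t : ℝ, 0 < t * ‖v‖ - C → (t * ‖v‖ - C) ^ (-(2 * Δ)) * K ≤ 1 →
      0 ≤ S (n + m) (Fin.append x fun j => y j + t • v) ∧
        S (n + m) (Fin.append x fun j => y j + t • v) ≤
          (Nat.factorial (2 * k) : ℝ) * M ^ (k - 1) * ((t * ‖v‖ - C) ^ (-(2 * Δ)) * K) := by
    intro t hLt hεt
    have hfar : ∀ i j, t * ‖v‖ - C ≤ ‖x i - (y j + t • v)‖ := fun i j => by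
      have h1 := sub_norm_le_norm_sub_add_smul (x i) (y j) v t
      have h2 := hC i j
      linarith
    have hinj : Function.Injective (Fin.append x fun j => y j + t • v) :=
      append_add_injective hx hy hLt hfar
    have hpos : 0 < S (n + m) (Fin.append x fun j => y j + t • v) :=
      InversionDefectInvolution.stub_evenPos ρ S hρ hlim hnd _ ⟨k, by omega⟩ _ hinj
    refine ⟨hpos.le, ?_⟩
    rw [← corr_comp_cast S hk]
    have hinj' : Function.Injective ((Fin.append x fun j => y j + t • v) ∘ Fin.cast hk) :=
      hinj.comp (Fin.cast_injective hk)
    refine (hGD ρ S hρ hlim k ((Fin.append x fun j => y j + t • v) ∘ Fin.cast hk) hinj').trans ?_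
    refine h6a (fun a b => S 2 ![a, b]) k ((Fin.append x fun j => y j + t • v) ∘ Fin.cast hk)
      (Finset.univ.filter fun i : Fin (2 * k) => (i : ℕ) < n) M
      ((t * ‖v‖ - C) ^ (-(2 * Δ)) * K) ?_ hM0 (mul_nonneg (Real.rpow_nonneg hLt.le _) hK0) ?_ ?_
    · -- the `x`-block has `n` indices, an odd number
      rw [Fin.card_filter_val_lt, Nat.min_eq_right (by omega)]
      exact hn
    · -- all pairs: non-negative (injectivity, non-degeneracy) and at most `M`
      intro i j hij
      exact ⟨(hnd _ (pair_mem_nonCoincident (hinj'.ne hij))).le,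
        pair_le_of_blocks hnd heuc hsc hΔ hLt hfar (hεt.trans hM1)
          (fun i i' => (hMx i i').trans hMxM) (fun j j' => (hMy j j').trans hMyM) _ _⟩
    · -- cross pairs: at most `ε(t)`
      intro i j hi hj
      simp only [Finset.mem_filter, Finset.mem_univ, true_and] at hi hj
      exact cross_pair_le hnd heuc hsc hΔ hLt hfar hi hj
  refine squeeze_zero' (hev.mono fun t ht => (key t ht.1 ht.2).1)
    (hev.mono fun t ht => (key t ht.1 ht.2).2) ?_
  simpa only [mul_zero] using hε.const_mul ((Nat.factorial (2 * k) : ℝ) * M ^ (k - 1))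

/-! ### The registered stub -/

/-- **Odd|odd blocks decay.** See the module docstring; proof route: non-injective `x` or `y` ⇒ `≡ 0` by
normalisation; else eventually injective, `0 ≤ S_{n+m}` (`InversionDefectInvolution.stub_evenPos`), Gaussian
domination after `Fin.cast` (`corr_comp_cast`), and 6a with `A` = the `x`-block: internal pair values `t`-independent
(translation invariance for the `y`-pairs) and bounded, cross values `‖xᵢ - yⱼ - t v‖^(-2Δ) S₂(0,e₀) → 0`
(`InversionUpgradeNormalisedNegative.two_point_eq`, `Δ ≥ 1/2` by `delta_mem_Icc_of_hyp`). [cite: GlimmJaffe1987, §19.3] -/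
theorem stub_oddOddDecay :
    (∀ (f : EuclideanSpace ℝ (Fin 3) → EuclideanSpace ℝ (Fin 3) → ℝ) (k : ℕ)
      (z : Fin (2 * k) → EuclideanSpace ℝ (Fin 3)) (A : Finset (Fin (2 * k))) (M ε : ℝ),
      Odd A.card → 0 ≤ M → 0 ≤ ε →
      (∀ i j, i ≠ j → 0 ≤ f (z i) (z j) ∧ f (z i) (z j) ≤ M) →
      (∀ i j, i ∈ A → j ∉ A → f (z i) (z j) ≤ ε ∧ f (z j) (z i) ≤ ε) →
      pairingSum f k z ≤ (Nat.factorial (2 * k) : ℝ) * M ^ (k - 1) * ε) →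
    (∀ (ρ : ℝ → ℝ) (S : CorrFamily 3), (∀ δ ∈ Set.Ioc (0:ℝ) 1, 0 < ρ δ) →
      HasPointwiseScalingLimit (criticalCorr 3) ρ S →
      ∀ (n : ℕ) (x : Fin (2 * n) → EuclideanSpace ℝ (Fin 3)), x ∈ NonCoincident 3 (2 * n) →
        S (2 * n) x ≤ pairingSum (fun a b => S 2 ![a, b]) n x) →
    ∀ (ρ : ℝ → ℝ) (Δ : ℝ) (S : CorrFamily 3), (∀ δ ∈ Set.Ioc (0:ℝ) 1, 0 < ρ δ) →
      HasPointwiseScalingLimit (criticalCorr 3) ρ S → (∀ n z, z ∉ NonCoincident 3 n → S n z = 0) →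
      IsNondegenerateTwoPoint S → IsEuclideanInvariant S → IsScaleCovariant Δ S →
      ∀ (n m : ℕ) (x : Fin n → EuclideanSpace ℝ (Fin 3)) (y : Fin m → EuclideanSpace ℝ (Fin 3))
        (v : EuclideanSpace ℝ (Fin 3)), Odd n → Odd m → v ≠ 0 →
        Tendsto (fun t : ℝ => S (n + m) (Fin.append x (fun j => y j + t • v))) atTop (𝓝 0) := by
  intro h6a hGD ρ Δ S hρ hlim hnorm hnd heuc hsc n m x y v hn hm hv
  by_cases hxy : Function.Injective x ∧ Function.Injective y
  · exact tendsto_append_add_smul_of_injective h6a hGD hρ hlim hnd heuc hsc hxy.1 hxy.2 hn hm hv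
  · -- degenerate blocks: `(x, y + t v)` is never injective, the correlator vanishes identically
    exact tendsto_const_nhds.congr fun t =>
      (hnorm _ _ fun hinj => hxy (injective_of_append_add hinj)).symm

end Summit.CriticalPhenomena.Ising3DConformalLimit.Cruxes.InversionUpgradeNormalised.FreeEndpointGaussianClosure

end
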